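import Literature.AlgebraicGeometry.Resolution.KnafKuhlmann2009HenselianRationality
import Literature.AlgebraicGeometry.Resolution.AbhyankarEtaleAscent
import HarnessLib

/-!
# Knaf–Kuhlmann 2009, Thm. 3.8 in local-étale form, and Lemma 3.7 (2) proved

Topic: `Literature/AlgebraicGeometry/Resolution`. After `KnafKuhlmann2009Prop310.lean`
(`KnafKuhlmann2009_Prop310_sepClosed`, hence KK09 Thm. 1.1 and the fact `KnafKuhlmann2009` = KK09
Thm. 1.2, from `KnafKuhlmann2009_Thm38_Lemma37_sepClosed`) the named fact `KnafKuhlmann2009` rests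
on exactly two named facts, `KnafKuhlmann2009_Thm38_Lemma37_sepClosed`
(`KnafKuhlmann2009HenselianRationality.lean`: KK09 Thm. 3.8 = F.-V. Kuhlmann's henselian
rationality [K8], combined with Lemma 3.7 (2), (3), in the form "there is a transcendence basis
`{x} ⊆ F` with `P` strongly smoothly `O_{K(x)}`-uniformizable") and `KnafKuhlmann2005_Thm34_etale`
(`AbhyankarEtaleAscent.lean`: KK05 Thm. 3.4 in the standard-étale form of KK05 §5). This file
splits the first along the printed text (it imports neither `KnafKuhlmann2009Prop310.lean` nor
`KnafKuhlmann2009Thm11.lean`; compose `KnafKuhlmann2009_Thm38_Lemma37_sepClosed.of_localEtale`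
below with the theorems of those files to reach Prop. 3.10, Thm. 1.1 and Thm. 1.2). Lemma 3.7 reads (p. 13 of the arXiv PDF): "Let `(F|L,P)` be a finite valued field
extension […] 2. `P` is strongly smoothly `O_L`-uniformizable if and only if `O_P|O_L` is
local-étale. 3. `O_P|O_L` is local-étale if and only if `(F,P)` lies in the absolute inertia
field of `(L,P)`." with "2.: The remaining implication ⇐ is obvious. 3.: See [Ray], Ch. X.,
Thm. 1."; and local-étale means, as in KK05 §5 (p. 12, the passage vendored with
`KnafKuhlmann2005_Thm34_etale`): "`O_F = A_q` for an étale `O_E`-algebra `A` and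
`q = A ∩ M_F`. According to [Ray], Ch. V, Thm. 1 we can assume that `A` is standard-étale,
i.e. `A = O_E[x]_{g(x)}`, where `O_E[x] = O_E[X]/fO_E[X]` with a monic polynomial
`f ∈ O_E[X]` […] Claim: In the definition of `A` we can assume `f` to be prime."

* `KnafKuhlmann2009_Thm38_localEtale_sepClosed` — NAMED FACT: Thm. 3.8 with Lemma 3.7 (3) (and
  [Ray] V Thm. 1, the Claim of KK05 §5), over a separably closed ground field, in the SAME
  standard-étale rendering as `KnafKuhlmann2005_Thm34_etale`: for `(F|K, P)` an immediate
  separable function field of transcendence degree `1` over the separably closed `K`, there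
  are a transcendence basis `{x} ⊆ F` of `F|K` — with `E := K(x)` — an element `η ∈ O_F` with
  `F = E(η)`, a monic `f` over `O_E` with `f(η) = 0` of least degree among the non-zero
  polynomials over `E` vanishing at `η`, polynomials `g, h, p₂` over `O_E` and `s` with
  `f'h + f p₂ = gˢ`, `g(η) ∈ O_F^×`, and `O_F = (O_E[η]_{g(η)})_q`: every `z ∈ O_F` is
  `a(η)/(b(η) g(η)ᵏ)` with `a, b` over `O_E`, `b(η) ∈ O_F^×`. (Thm. 3.8 gives `x` with
  `F ⊆ K(x)^h ⊆ K(x)^i`, the absolute inertia field; Lemma 3.7 (3) = [Ray] X Thm. 1 makes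
  `O_F|O_{K(x)}` local-étale; [Ray] V Thm. 1 and the Claim give the standard-étale `A` with
  `f` prime, i.e. of least degree.)
* `exists_standardEtale_model_subring` — PROVED, **Lemma 3.7 (2) ⇐ made explicit**: over ANY
  subring `B ⊆ O_V ∩ F` of `Ω`, standard-étale data `η, f, g, h, p₂, s` as above (`f` monic
  over `B` of least degree among the non-zero polynomials over `B` vanishing at `η`,
  `f'h + f p₂ = gˢ`, `v(g(η)) = 0`) generate a `B`-subalgebra `A = B[η]_{g(η)} ⊆ O_V ∩ F`
  which is finitely presented and formally smooth over `B` (`A ≅ (B[X]/(f))_g`, Mathlib's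
  `StandardEtalePair`; the kernel of `B[X] → Ω`, `X ↦ η`, is `(f)` by monic division and
  minimality — no normality of `B` is needed). The twin of `exists_standardEtale_model`
  (`AbhyankarEtaleAscent.lean`, base a smooth normal `K`-algebra) for a subring base.
* `KnafKuhlmann2009_Thm38_Lemma37_sepClosed.of_localEtale` — PROVED: the local-étale fact
  implies `KnafKuhlmann2009_Thm38_Lemma37_sepClosed` (the model `O_{K(x)}[η]_{g(η)}` serves
  every finite `Z ⊆ O_F`).
* Consequently Prop. 3.10, Thm. 1.1 and the fact `KnafKuhlmann2009` follow from
  `{KnafKuhlmann2009_Thm38_localEtale_sepClosed, KnafKuhlmann2005_Thm34_etale}` — two statements of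
  pure valuation theory in one standard-étale rendering — by composing `of_localEtale` with the
  theorems of `KnafKuhlmann2009Prop310.lean`.

## Sources

* [KK09] H. Knaf, F.-V. Kuhlmann, *Every place admits local uniformization in a finite extension
  of the function field*, Adv. Math. 221 (2009) 428–453 = arXiv:math/0702856: §1 p. 5
  ("inertially generated", "henselian generated"), §2.1 p. 7 (henselization `K^h` as the
  decomposition field, absolute inertia field `K^i ⊇ K^h`), §2.3 p. 8 (separably tame), §3.1
  p. 11 (standard-étale algebras), Lemma 3.7 and Thm. 3.8 (p. 13), proof of Prop. 3.10 (p. 14).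
  Pages of the 19-page arXiv PDF.
* [KK05] H. Knaf, F.-V. Kuhlmann, *Abhyankar places admit local uniformization in any
  characteristic*, Ann. Sci. ÉNS 38 (2005) 833–846 = arXiv:math/0304159, §5 p. 12 (local-étale
  extensions of valuation rings are localisations of standard-étale algebras with `f` prime).
* [K8] F.-V. Kuhlmann, *Elimination of ramification II: Henselian rationality*, Israel J. Math.
  234 (2019) 927–958 = arXiv:1701.05508 (bib key `Kuhlmann2019`), Thm. 1.3 (transcendence
  degree `1`: "Let `(K, v)` be a separably tame field and `(F|K, v)` an immediate function field,
  with `F|K` a separable extension. If its transcendence degree over `K` is `1`, then `(F|K, v)` is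
  henselian rational.") (the proof of Thm. 3.8).
* [Ray] M. Raynaud, *Anneaux locaux henséliens*, LNM 169 (1970), Ch. V Thm. 1, Ch. X Thm. 1.

## Rendering notes

As in `KnafKuhlmann2009HenselianRationality.lean` and `AbhyankarEtaleAscent.lean`: `(Ω, V)` one
valued field, `K ≤ F` subfields, `E = K(x) = Subfield.closure (K ∪ {x})`, `O_M = V ∩ M`;
polynomials "over `O_E`" are polynomials over `Ω` with coefficients in `V ∩ E`; "`f` prime" ↦
`f` monic of least degree among the non-zero polynomials over `E` vanishing at `η`; a unit of
`O_F` ↦ value `1`; "`O_F = A_q`" ↦ the displayed representation of the elements of `O_F`. The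
separable closedness of `K` makes `(K, P)` separably tame for every `P` (module docstring of
`KnafKuhlmann2009HenselianRationality.lean`); the place is non-trivial on `K` automatically (an
immediate `F ≠ K` forces it), as Thm. 3.8 requires.
-/

noncomputable section

namespace Literature.AlgebraicGeometry.Resolution

universe u

open IsLocalRing Polynomial

/-- NAMED FACT — **Knaf–Kuhlmann 2009, Thm. 3.8 with Lemma 3.7 (3), local-étale form, over a
separably closed ground field** (Thm. 3.8: "Let `(F|K,P)` be an immediate, valued function
field of transcendence degree 1 and assume that `(K,P)` is separably tame. If `F|K` is
separable, then there exists `x ∈ F` such that `(F,P)` lies in the henselization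
`(K(x)^h,P^h)`, that is `(F|K,P)` is henselian generated."; Lemma 3.7 (3): "`O_P|O_L` is
local-étale if and only if `(F,P)` lies in the absolute inertia field of `(L,P)`" — [Ray] X
Thm. 1 —, the henselization lying in the absolute inertia field (§2.1); local-étale unfolded as
in Knaf–Kuhlmann 2005, §5 p. 12: "`O_F = A_q` for an étale `O_E`-algebra `A` […] we can assume
that `A` is standard-étale, i.e. `A = O_E[x]_{g(x)}`, where `O_E[x] = O_E[X]/fO_E[X]` with a
monic polynomial `f ∈ O_E[X]` […] the image of the derivative `f'` […] is a unit. Claim: […] we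
can assume `f` to be prime."). Rendering (module docstring), for `K` separably closed and
`(F|K, P)` immediate, separable, of transcendence degree `1`: a transcendence basis `{x} ⊆ F`,
`E := K(x)`, `η ∈ O_F` with `F = E(η)`, `f` monic over `O_E` with `f(η) = 0` and of least degree
among the non-zero polynomials over `E` vanishing at `η`, `f'h + f p₂ = gˢ` over `O_E` with
`g(η)` a unit of `O_F`, and every `z ∈ O_F` of the form `a(η)/(b(η) g(η)ᵏ)`, `a, b` over `O_E`,
`b(η)` a unit. Users take `(h : KnafKuhlmann2009_Thm38_localEtale_sepClosed)`.
[cite: KnafKuhlmann2009, Thm. 3.8 and Lemma 3.7 (3)] -/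
def KnafKuhlmann2009_Thm38_localEtale_sepClosed : Prop :=
  ∀ (Ω : Type u) [Field Ω] (V : ValuationSubring Ω) (K F : Subfield Ω), IsSepClosed K →
    K ≤ F → FGOver K F → SeparablyGeneratedOver K F →
    (∃ x ∈ F, Transcendental K x ∧
      ∀ z ∈ F, IsAlgebraic (IntermediateField.adjoin K ({x} : Set Ω)) z) →
    IsImmediateOver V K F →
    ∃ x ∈ F, Transcendental K x ∧
      ∃ (η : Ω) (f g h p₂ : Polynomial Ω) (s : ℕ),
        η ∈ V ∧
        Subfield.closure ((Subfield.closure ((K : Set Ω) ∪ {x}) : Set Ω) ∪ {η}) = F ∧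
        f.Monic ∧ f.eval η = 0 ∧
        (∀ P ∈ ({f, g, h, p₂} : Set (Polynomial Ω)), ∀ k, P.coeff k ∈ V ∧
          P.coeff k ∈ Subfield.closure ((K : Set Ω) ∪ {x})) ∧
        (∀ P : Polynomial Ω, (∀ k, P.coeff k ∈ Subfield.closure ((K : Set Ω) ∪ {x})) →
          P ≠ 0 → P.eval η = 0 → f.natDegree ≤ P.natDegree) ∧
        Polynomial.derivative f * h + f * p₂ = g ^ s ∧
        V.valuation (g.eval η) = 1 ∧
        ∀ z ∈ F, z ∈ V → ∃ (a b : Polynomial Ω) (k : ℕ),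
          (∀ P ∈ ({a, b} : Set (Polynomial Ω)), ∀ k, P.coeff k ∈ V ∧
            P.coeff k ∈ Subfield.closure ((K : Set Ω) ∪ {x})) ∧
          V.valuation (b.eval η) = 1 ∧ z = a.eval η / (b.eval η * g.eval η ^ k)

variable {Ω : Type u} [Field Ω]

/-! ## Polynomials over `Ω` with coefficients in a subring -/

/-- A polynomial over `Ω` all of whose coefficients lie in the subring `B` is the image of a
polynomial over `B`; a monic one of a monic one. [folklore] -/
theorem exists_map_eq_of_coeff_mem_subring (B : Subring Ω) (P : Polynomial Ω)
    (hP : ∀ k, P.coeff k ∈ B) :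
    ∃ Q : Polynomial B, Q.map (algebraMap B Ω) = P ∧ (P.Monic → Q.Monic) := by
  have hl : P ∈ Polynomial.lifts (algebraMap B Ω) :=
    (Polynomial.lifts_iff_coeff_lifts P).mpr fun k => ⟨⟨P.coeff k, hP k⟩, rfl⟩
  by_cases hmon : P.Monic
  · obtain ⟨Q, hQ, -, hQm⟩ := Polynomial.lifts_and_degree_eq_and_monic hl hmon
    exact ⟨Q, hQ, fun _ => hQm⟩
  · obtain ⟨Q, hQ⟩ := (Polynomial.mem_lifts P).mp hl
    exact ⟨Q, hQ, fun h => (hmon h).elim⟩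

/-- `aeval η Q = (Q.map (B → Ω)).eval η` for a subring `B`. [folklore] -/
theorem aeval_eq_eval_map_subring (B : Subring Ω) (Q : Polynomial B) (η : Ω) :
    Polynomial.aeval η Q = (Q.map (algebraMap B Ω)).eval η := by
  rw [Polynomial.aeval_def, Polynomial.eval_map]

/-! ## Lemma 3.7 (2) ⇐: the standard-étale model over a subring base -/

/-- **The standard-étale model over a subring** (Knaf–Kuhlmann 2009, Lemma 3.7 (2), "⇐ is
obvious", made explicit; twin of `exists_standardEtale_model` for a subring base): let
`B ⊆ O_V ∩ F` be a subring of `Ω`, `η ∈ O_V ∩ F`, `f ∈ B[X]` monic with `f(η) = 0` and of least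
degree among the non-zero polynomials over `B` vanishing at `η`, and `f'h + f p₂ = gˢ` in `B[X]`
with `g(η)` a unit of `O_V`. Then the kernel of `B[X] → Ω`, `X ↦ η`, is `(f)` (monic division
and minimality), so `A := B[η]_{g(η)} ≅ (B[X]/(f))_g` is standard étale over `B`; hence
`A ⊆ O_V ∩ F` is finitely presented and formally smooth over `B` and contains `B[η]`.
[cite: KnafKuhlmann2009, Lemma 3.7 (2)] -/
theorem exists_standardEtale_model_subring (V : ValuationSubring Ω) (B : Subring Ω)
    (hBV : B ≤ V.toSubring) {F : Subfield Ω} (hBF : (B : Set Ω) ⊆ F) {η : Ω} (hηV : η ∈ V)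
    (hηF : η ∈ F) (fB gB hB p₂B : Polynomial B) (s : ℕ) (hfBmon : fB.Monic)
    (hfBη : Polynomial.aeval η fB = 0)
    (hfBmin : ∀ q : Polynomial B, q ≠ 0 → Polynomial.aeval η q = 0 → fB.natDegree ≤ q.natDegree)
    (hidentB : Polynomial.derivative fB * hB + fB * p₂B = gB ^ s)
    (hvg : V.valuation (Polynomial.aeval η gB) = 1) :
    ∃ (A : Subalgebra B Ω) (hAV : A.toSubring ≤ V.toSubring), (A : Set Ω) ⊆ F ∧
      Algebra.FinitePresentation B A ∧ Algebra.FormallySmooth B A ∧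
      Algebra.IsSmoothAt B (centre A V hAV) ∧
      ∀ q : Polynomial B, Polynomial.aeval η q ∈ A := by
  classical
  have hgη0 : Polynomial.aeval η gB ≠ 0 := fun h0 => by
    rw [h0, map_zero] at hvg
    exact zero_ne_one hvg
  have hinj : Function.Injective (algebraMap B Ω) := Subtype.val_injective
  -- the kernel of `X ↦ η` on `B[X]` is `(fB)`: monic division and minimality
  have hdvd : ∀ q : Polynomial B, Polynomial.aeval η q = 0 → fB ∣ q := by
    intro q hq
    have hmod : Polynomial.aeval η (q %ₘ fB) = 0 := by
      have h := Polynomial.modByMonic_add_div q fB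
      have h' : Polynomial.aeval η (q %ₘ fB + fB * (q /ₘ fB)) = Polynomial.aeval η q :=
        congrArg (Polynomial.aeval η) h
      rw [map_add, map_mul, hfBη, zero_mul, add_zero, hq] at h'
      exact h'
    have hzero : q %ₘ fB = 0 := by
      by_contra hne
      have h1 := hfBmin _ hne hmod
      have h2 : (q %ₘ fB).natDegree < fB.natDegree := by
        have hfB1 : fB ≠ 1 := by
          intro h1'
          rw [h1', map_one] at hfBη
          exact one_ne_zero hfBη
        exact Polynomial.natDegree_modByMonic_lt q hfBmon hfB1
      exact absurd h1 (not_le.mpr h2)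
    exact (Polynomial.modByMonic_eq_zero_iff_dvd hfBmon).mp hzero
  -- `φ₀ : B[X]/(f) → Ω`, `X ↦ η`, is injective
  let φ₀ : AdjoinRoot fB →ₐ[B] Ω := AdjoinRoot.liftAlgHom fB (Algebra.ofId B Ω) η
    (by rw [Algebra.toRingHom_ofId, ← Polynomial.aeval_def]; exact hfBη)
  have hφ₀mk : ∀ q : Polynomial B, φ₀ (AdjoinRoot.mk fB q) = Polynomial.aeval η q := fun q => by
    simp only [φ₀, AdjoinRoot.liftAlgHom_mk, Polynomial.aeval_def, Algebra.toRingHom_ofId]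
  have hφ₀ : Function.Injective φ₀ := by
    rw [injective_iff_map_eq_zero]
    intro p hp
    obtain ⟨q, rfl⟩ := AdjoinRoot.mk_surjective p
    rw [hφ₀mk] at hp
    rw [AdjoinRoot.mk_eq_zero]
    exact hdvd q hp
  -- the standard-étale algebra `L = (B[X]/(f))[1/g]` and `ψ : L → Ω`
  set r : AdjoinRoot fB := AdjoinRoot.mk fB gB with hr
  have hφ₀r : φ₀ r = Polynomial.aeval η gB := by rw [hr, hφ₀mk]
  have hrunit : IsUnit (φ₀ r) := by rw [hφ₀r]; exact isUnit_iff_ne_zero.mpr hgη0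
  let L := Localization.Away r
  let ψ : L →ₐ[B] Ω := IsLocalization.Away.liftAlgHom r (f := φ₀) hrunit
  have hψalg : ∀ a : AdjoinRoot fB, ψ (algebraMap (AdjoinRoot fB) L a) = φ₀ a := fun a => by
    simp only [ψ, IsLocalization.Away.coe_liftAlgHom, IsLocalization.Away.lift_eq]
    rfl
  have hnf : ∀ l : L, ∃ (q : Polynomial B) (n : ℕ),
      ψ l = Polynomial.aeval η q / Polynomial.aeval η gB ^ n := by
    intro l
    obtain ⟨⟨a, m⟩, hlm⟩ := IsLocalization.surj (Submonoid.powers r) l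
    obtain ⟨n, hn⟩ := (Submonoid.mem_powers_iff _ _).mp m.2
    obtain ⟨q, rfl⟩ := AdjoinRoot.mk_surjective a
    refine ⟨q, n, ?_⟩
    have h1 : ψ l * Polynomial.aeval η gB ^ n = Polynomial.aeval η q := by
      have := congrArg ψ hlm
      rw [map_mul, hψalg, hψalg, hφ₀mk] at this
      rw [← this, ← hn, map_pow, hφ₀r]
    rw [← h1, mul_div_assoc, div_self (pow_ne_zero n hgη0), mul_one]
  have hψ : Function.Injective ψ := by
    rw [injective_iff_map_eq_zero]
    intro l hl
    obtain ⟨⟨a, m⟩, hlm⟩ := IsLocalization.surj (Submonoid.powers r) l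
    have h1 : φ₀ a = 0 := by
      have := congrArg ψ hlm
      rw [map_mul, hψalg, hψalg, hl, zero_mul] at this
      exact this.symm
    have ha : a = 0 := hφ₀ (by rw [h1, map_zero])
    rw [ha, map_zero] at hlm
    exact (IsLocalization.map_units L m).mul_left_eq_zero.mp hlm
  -- `L` is standard étale over `B`; so is its image `A = ψ(L) ⊆ Ω`
  let SE : StandardEtalePair B :=
    { f := fB, monic_f := hfBmon, g := gB, cond := ⟨hB, p₂B, s, hidentB⟩ }
  haveI : Algebra.IsStandardEtale B L := Algebra.IsStandardEtale.of_equiv SE.equivAwayAdjoinRoot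
  haveI : Algebra.Etale B L := inferInstance
  haveI hfsL : Algebra.FormallySmooth B L := inferInstance
  haveI hfpL : Algebra.FinitePresentation B L := inferInstance
  set A : Subalgebra B Ω := ψ.range
  let eA : L ≃ₐ[B] A := AlgEquiv.ofInjective ψ hψ
  have hfpA : Algebra.FinitePresentation B A := Algebra.FinitePresentation.equiv eA
  haveI hfsA : Algebra.FormallySmooth B A := Algebra.FormallySmooth.of_equiv eA
  -- membership facts for `A`
  have hmemA : ∀ w : Ω, w ∈ A ↔ ∃ l, ψ l = w := fun w => AlgHom.mem_range ψ
  have hpolyA : ∀ q : Polynomial B, Polynomial.aeval η q ∈ A := fun q =>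
    (hmemA _).mpr ⟨algebraMap _ L (AdjoinRoot.mk fB q), by rw [hψalg, hφ₀mk]⟩
  have hnumV : ∀ q : Polynomial B, Polynomial.aeval η q ∈ V := fun q => by
    rw [aeval_eq_eval_map_subring]
    exact eval_mem_of_coeff_mem V _
      (fun k => by rw [Polynomial.coeff_map]; exact hBV (q.coeff k).2) hηV
  have hnumF : ∀ q : Polynomial B, Polynomial.aeval η q ∈ F := fun q => by
    rw [aeval_eq_eval_map_subring]
    exact eval_mem_of_coeff_mem F _
      (fun k => by rw [Polynomial.coeff_map]; exact hBF (q.coeff k).2) hηF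
  have hgpowV : ∀ n : ℕ, (Polynomial.aeval η gB ^ n)⁻¹ ∈ V := fun n =>
    (V.valuation_le_one_iff _).mp (by rw [map_inv₀, map_pow, hvg, one_pow, inv_one])
  have hAV : A.toSubring ≤ V.toSubring := by
    intro w hw
    obtain ⟨l, rfl⟩ := (hmemA w).mp hw
    obtain ⟨q, n, hq⟩ := hnf l
    rw [hq, div_eq_mul_inv]
    exact mul_mem (hnumV q) (hgpowV n)
  have hAF : (A : Set Ω) ⊆ F := by
    intro w hw
    obtain ⟨l, rfl⟩ := (hmemA w).mp hw
    obtain ⟨q, n, hq⟩ := hnf l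
    rw [hq]
    exact div_mem (hnumF q) (pow_mem (hnumF gB) n)
  exact ⟨A, hAV, hAF, hfpA, hfsA, isSmoothAt_of_formallySmooth _, hpolyA⟩

/-! ## `KnafKuhlmann2009_Thm38_Lemma37_sepClosed` from the local-étale form -/

/-- **Lemma 3.7 (2) ⇐ applied to the data of Thm. 3.8 + Lemma 3.7 (3)**: the local-étale fact
`KnafKuhlmann2009_Thm38_localEtale_sepClosed` implies `KnafKuhlmann2009_Thm38_Lemma37_sepClosed`
("`P` is strongly smoothly `O_{K(x)}`-uniformizable"): with `E := K(x)` and the coefficients of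
`f, g, h, p₂` lifted to `O_E = V ∩ E`, the standard-étale model `A := O_E[η]_{g(η)} ⊆ O_F`
(`exists_standardEtale_model_subring`) is finitely presented and smooth over `O_E`, has
`Frac A = E(η) = F`, and contains every `z = a(η)/(b(η) g(η)ᵏ) ∈ O_F` in its local ring at
the centre — one model for all finite `Z ⊆ O_F`.
[cite: KnafKuhlmann2009, Lemma 3.7 (2) and proof of Prop. 3.10] -/
theorem KnafKuhlmann2009_Thm38_Lemma37_sepClosed.of_localEtale
    (h : KnafKuhlmann2009_Thm38_localEtale_sepClosed.{u}) :
    KnafKuhlmann2009_Thm38_Lemma37_sepClosed.{u} := by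
  intro Ω _ V K F hK hKF hfg hsep h1 himm
  classical
  obtain ⟨x, hxF, hx, η, f, g, hh, p₂, s, hηV, hEηF, hfmon, hfη, hcoef, hfmin, hident, hvg, hOF⟩ :=
    h Ω V K F hK hKF hfg hsep h1 himm
  refine ⟨x, hxF, hx, fun Z hZ => ?_⟩
  set E : Subfield Ω := Subfield.closure ((K : Set Ω) ∪ {x})
  set B : Subring Ω := V.toSubring ⊓ E.toSubring
  have hBV : B ≤ V.toSubring := inf_le_left
  have hEF : E ≤ F :=
    Subfield.closure_le.mpr (Set.union_subset hKF (Set.singleton_subset_iff.mpr hxF))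
  have hBF : (B : Set Ω) ⊆ F := fun w hw => hEF hw.2
  have hηF : η ∈ F := by
    rw [← hEηF]
    exact Subfield.subset_closure (Or.inr rfl)
  have hinj : Function.Injective (algebraMap B Ω) := Subtype.val_injective
  -- the polynomials over `B = O_E`
  have hcoefB : ∀ P : Polynomial Ω, (∀ k, P.coeff k ∈ V ∧ P.coeff k ∈ E) → ∀ k, P.coeff k ∈ B :=
    fun P hP k => ⟨(hP k).1, (hP k).2⟩
  obtain ⟨fB, hfB, hfBmon'⟩ := exists_map_eq_of_coeff_mem_subring B f (hcoefB f (hcoef f (by simp)))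
  have hfBmon : fB.Monic := hfBmon' hfmon
  obtain ⟨gB, hgB, -⟩ := exists_map_eq_of_coeff_mem_subring B g (hcoefB g (hcoef g (by simp)))
  obtain ⟨hB, hhB, -⟩ := exists_map_eq_of_coeff_mem_subring B hh (hcoefB hh (hcoef hh (by simp)))
  obtain ⟨p₂B, hp₂B, -⟩ :=
    exists_map_eq_of_coeff_mem_subring B p₂ (hcoefB p₂ (hcoef p₂ (by simp)))
  have hidentB : Polynomial.derivative fB * hB + fB * p₂B = gB ^ s := by
    apply Polynomial.map_injective (algebraMap B Ω) hinj
    simp only [Polynomial.map_mul, Polynomial.map_add, Polynomial.map_pow,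
      ← Polynomial.derivative_map, hfB, hgB, hhB, hp₂B]
    exact hident
  have hfBη : Polynomial.aeval η fB = 0 := by rw [aeval_eq_eval_map_subring, hfB]; exact hfη
  have hgBη : Polynomial.aeval η gB = g.eval η := by rw [aeval_eq_eval_map_subring, hgB]
  have hvgB : V.valuation (Polynomial.aeval η gB) = 1 := by rw [hgBη]; exact hvg
  have hfBmin : ∀ q : Polynomial B, q ≠ 0 → Polynomial.aeval η q = 0 →
      fB.natDegree ≤ q.natDegree := by
    intro q hq0 hq'
    have hqE : ∀ k, (q.map (algebraMap B Ω)).coeff k ∈ E := fun k => by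
      rw [Polynomial.coeff_map]
      exact (q.coeff k).2.2
    have hq'0 : q.map (algebraMap B Ω) ≠ 0 := (Polynomial.map_ne_zero_iff hinj).mpr hq0
    have hev : (q.map (algebraMap B Ω)).eval η = 0 := by
      rw [← aeval_eq_eval_map_subring]; exact hq'
    have h1 := hfmin _ hqE hq'0 hev
    rwa [Polynomial.natDegree_map_eq_of_injective hinj, ← hfB,
      Polynomial.natDegree_map_eq_of_injective hinj] at h1
  -- the standard-étale model `A = O_E[η]_{g(η)}`
  obtain ⟨A, hAV, hAF, hfpA, -, hsmA, hpolyA⟩ := exists_standardEtale_model_subring V B hBV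
    hBF hηV hηF fB gB hB p₂B s hfBmon hfBη hfBmin hidentB hvgB
  have hBA : ∀ b : Ω, b ∈ B → b ∈ A := fun b hb => by
    have := hpolyA (Polynomial.C ⟨b, hb⟩)
    rwa [Polynomial.aeval_C] at this
  have hηA : η ∈ A := by
    have := hpolyA Polynomial.X
    rwa [Polynomial.aeval_X] at this
  refine ⟨A, hAV, hAF, hfpA, fun w hw => ?_, hsmA, fun z hz => ?_⟩
  · -- `Frac A = F`
    have hEA : E ≤ Subfield.closure (A : Set Ω) :=
      subfield_le_closure_of_inf_subset V E fun u hu => hBA u hu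
    have hwc : w ∈ Subfield.closure (A : Set Ω) := by
      rw [← hEηF] at hw
      refine (Subfield.closure_le.mpr ?_) hw
      rintro u (hu | rfl)
      · exact hEA hu
      · exact Subfield.subset_closure hηA
    exact exists_div_of_mem_closure A.toSubring hwc
  · -- `Z ⊆ A_q`
    have hz' : z ∈ Z := Finset.mem_coe.mp hz
    obtain ⟨a, b, k, hab, hvb, hzeq⟩ := hOF z (hZ z hz').2 (hZ z hz').1
    obtain ⟨aB, haB, -⟩ := exists_map_eq_of_coeff_mem_subring B a (hcoefB a (hab a (by simp)))
    obtain ⟨bB, hbB, -⟩ := exists_map_eq_of_coeff_mem_subring B b (hcoefB b (hab b (by simp)))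
    refine ⟨a.eval η, ?_, b.eval η * g.eval η ^ k, ?_, ?_, hzeq⟩
    · rw [← haB, ← aeval_eq_eval_map_subring]
      exact hpolyA aB
    · refine mul_mem ?_ (pow_mem ?_ _)
      · rw [← hbB, ← aeval_eq_eval_map_subring]
        exact hpolyA bB
      · rw [← hgBη]
        exact hpolyA gB
    · rw [map_mul, map_pow, hvb, hvg, one_pow, one_mul]

end Literature.AlgebraicGeometry.Resolution

end
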